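import Summits.BirchSwinnertonDyer.BirchSwinnertonDyer.Theses.BiquadraticEisensteinDescent
import HarnessLib

/-!
# Route BiquadraticEisensteinDescent — assembly item `Assembly` (stmt-BirchSwinnertonDyer-20455)

`Assembly := (E♭°) → (W♭) → (C′) → R₃ → R₅₇ → PublishedInputsBiquadratic → KS → HsiehAnyLevelInput →
Summit.BirchSwinnertonDyer.WAllCornerFInertBad` is the rev-8 text of the route's deciding theorem. Since the
tenure planner's pattern-β edits (revs 10–13) the certified `closes` consumes (W♭) and (C′) through the by-name
items `KatzWaldspurgerFrameCMInertBadFlatOfLZZ := ThmA → LZZ18 → body` and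
`ControlCMInertBadAdmOtherOfGZK := GZ → Kolyvagin → modularity → body` plus the extra binder
`LiuZhangZhangAdditiveInput`, so `Assembly` is no longer literally the type of `closes`; it is the STRONGER-hypothesis
form (the bodies of (W♭)/(C′) granted outright), and this file proves it by re-running the certified `closes`
argument verbatim with the two by-name calls `h2 h8 h10 …` / `h3 hGZ hKo hmod …` replaced by the direct hypotheses.

HONEST FRAMING: THEOREMS ONLY (0 definitions, 0 named facts, 0 `sorry`). `Assembly` is an implication whose
antecedents are the route's items; proving it asserts nothing about those items. Prover seat bsd-wall-bed-p2 (g4),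
2026-08-27. Mathematical content of the glue (all tree theorems, cited by name in the proof): the inert-core one-datum
lemma `X12.bsdp_of_classX12_of_not_cmRamified_of_indexLowerBoundAt` (Gross–Zagier + Kolyvagin + MN19), optimal
isogenous curve + Manin constant (Edixhoven/Deuring or the `p ∈ {5,7}` residual), Cassels/Wuthrich isogeny invariance,
the `p = 3` residual, and the valuation algebra of halves over `𝓞_{ℂ_p}` at the trivial character.
-/

set_option autoImplicit false

-- D-0017 layout: summit = sub-problem, so `Summit.BirchSwinnertonDyer.BirchSwinnertonDyer.…` is the mandated namespace.
set_option linter.dupNamespace false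

namespace Summit.BirchSwinnertonDyer.BirchSwinnertonDyer.Theorems.BiquadraticEisensteinDescentAssembly

open Summit.BirchSwinnertonDyer.BirchSwinnertonDyer.Theses.BiquadraticEisensteinDescent

-- as in the route file: Mathlib's group law on affine points needs `DecidableEq K`.
open scoped Classical

/-- **Assembly of route BiquadraticEisensteinDescent (item stmt-BirchSwinnertonDyer-20455).** Granted the seven links
(E♭°) `EisensteinDivisibilityCMInertBadFlatAtOne`, (W♭) `KatzWaldspurgerFrameCMInertBadFlat`, (C′)
`ControlCMInertBadAdmOther`, R₃ `InertBadAtThree`, R₅₇ `ManinDatumFiveSevenCMInert`, `PublishedInputsBiquadratic`,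
KS `HeegnerFieldSupplyCMInertBadAdm` and the print input `HsiehAnyLevelInput`, the leaf
`Summit.BirchSwinnertonDyer.WAllCornerFInertBad` (BSD_p for every CM curve of analytic rank 1 at every inert-bad
`p ≠ 2`) follows. Proof = the route's certified deciding theorem `closes` (rev 13) run verbatim, with (W♭) and (C′)
supplied directly instead of through their by-name `…OfLZZ` / `…OfGZK` wrappers: at `p = 3` the residual R₃; at
`p ≥ 5` pass to the optimal isogenous curve `W₀` (Manin datum from Edixhoven/Deuring for `p > 7`, from R₅₇ at
`p ∈ {5,7}`), take the admissible Heegner field from KS, a Heegner datum and point, the ♭-frame with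
`Q(𝟙) = u·(log_ω P)²`, `‖u‖ ≤ 1` from (W♭), the divisibility `f_ac(0) ∈ Q(𝟙)·𝓞_{ℂ_p}` from (E♭°) and the control
inequality from (C′); the valuation algebra gives `X11b.IndexLowerBoundAt`, the inert-core lemma gives `BSDp W₀ p`,
and Cassels/Wuthrich transports it to `W`. -/
theorem assembly_proof :
    Summit.BirchSwinnertonDyer.BirchSwinnertonDyer.Theses.BiquadraticEisensteinDescent.Assembly := by
  unfold Summit.BirchSwinnertonDyer.BirchSwinnertonDyer.Theses.BiquadraticEisensteinDescent.Assembly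
  intro h1 h2 h3 h4 h5 h6 h7 h8
  obtain ⟨hGZ, hKo, hMN, hGZK, hmod, hnf, hFH, hCM8, hEdx, hDeu, hCassels⟩ := h6
  intro W _ _ p _ hCM hr hp2 hin hbad
  have hp : p.Prime := Fact.out
  by_cases hp3 : p = 3
  · subst hp3
    exact Literature.NumberTheory.EllipticCurves.Rank1Residual.Typed.bsdp_of_missingPPartAt W 3 hGZK
      hr.le (h4 W hCM hr hin hbad (fun h ↦ hin.2 h.2))
  have hp5 : 5 ≤ p := hp.five_le_of_ne_two_of_ne_three hp2 hp3
  have key : ∀ {f : Literature.NumberTheory.EllipticCurves.IwasawaAlgebra p}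
      (_ : PowerSeries.constantCoeff f ≠ 0) {Q : PowerSeries (PadicComplexInt p)}
      (_ : (Summit.BirchSwinnertonDyer.Rank1Residual.X11b.R1.toCpInt p) (PowerSeries.constantCoeff f) ∈
        Ideal.span {PowerSeries.constantCoeff Q})
      {u : PadicComplex p} (_ : ‖u‖ ≤ 1) {x : Padic p}
      (_ : Literature.NumberTheory.EllipticCurves.IntSeries.HasValueAt Q 0
        (u * (algebraMap (Padic p) (PadicComplex p) x) ^ 2)),
      x ≠ 0 ∧ 2 * x.valuation ≤ ((PowerSeries.constantCoeff f).valuation : ℤ) := by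
    intro f hf0 Q hfQ u hu x hQ
    have hQ0 : u * (algebraMap (Padic p) (PadicComplex p) x) ^ 2 =
        ((PowerSeries.constantCoeff Q : PadicComplexInt p) : PadicComplex p) :=
      Summit.BirchSwinnertonDyer.Rank1Residual.X11b.R1.intSeries_eq_constantCoeff_of_hasValueAt_zero p hQ
    obtain ⟨G0, hG0⟩ := Ideal.mem_span_singleton'.mp hfQ
    have hfac : algebraMap (Padic p) (PadicComplex p)
        ((PowerSeries.constantCoeff f : PadicInt p) : Padic p) =
        ((G0 : PadicComplexInt p) : PadicComplex p) *
          ((PowerSeries.constantCoeff Q : PadicComplexInt p) : PadicComplex p) := by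
      rw [← Summit.BirchSwinnertonDyer.Rank1Residual.X11b.R1.coe_toCpInt, ← hG0, MulMemClass.coe_mul]
    have hp1 : (1 : ℝ) < p := by exact_mod_cast hp.one_lt
    have hnormf : ‖((PowerSeries.constantCoeff f : PadicInt p) : Padic p)‖ ≤ ‖x‖ ^ 2 := by
      calc ‖((PowerSeries.constantCoeff f : PadicInt p) : Padic p)‖
          = ‖algebraMap (Padic p) (PadicComplex p)
              ((PowerSeries.constantCoeff f : PadicInt p) : Padic p)‖ := (norm_algebraMap' _ _).symm
        _ = ‖((G0 : PadicComplexInt p) : PadicComplex p)‖ *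
              ‖((PowerSeries.constantCoeff Q : PadicComplexInt p) : PadicComplex p)‖ := by
            rw [hfac, norm_mul]
        _ ≤ 1 * ‖((PowerSeries.constantCoeff Q : PadicComplexInt p) : PadicComplex p)‖ :=
            mul_le_mul_of_nonneg_right
              (Summit.BirchSwinnertonDyer.Rank1Residual.X11b.R1.norm_coe_padicComplexInt_le_one p _)
              (norm_nonneg _)
        _ = ‖u‖ * ‖algebraMap (Padic p) (PadicComplex p) x‖ ^ 2 := by
            rw [one_mul, ← hQ0, norm_mul, norm_pow]
        _ ≤ 1 * ‖algebraMap (Padic p) (PadicComplex p) x‖ ^ 2 :=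
            mul_le_mul_of_nonneg_right hu (pow_nonneg (norm_nonneg _) 2)
        _ = ‖x‖ ^ 2 := by rw [one_mul, norm_algebraMap']
    have hx0 : x ≠ 0 := by
      intro hx
      rw [hx, norm_zero, zero_pow two_ne_zero] at hnormf
      exact hf0 (PadicInt.coe_eq_zero.mp (norm_eq_zero.mp (le_antisymm hnormf (norm_nonneg _))))
    refine ⟨hx0, ?_⟩
    rw [← PadicInt.norm_def, PadicInt.norm_eq_zpow_neg_valuation hf0,
      Padic.norm_eq_zpow_neg_valuation hx0] at hnormf
    have hrhs : ((p : ℝ) ^ (-x.valuation)) ^ 2 = (p : ℝ) ^ (- (2 * x.valuation)) := by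
      rw [← zpow_natCast ((p : ℝ) ^ (-x.valuation)) 2, ← zpow_mul]
      congr 1
      push_cast
      ring
    rw [hrhs, zpow_le_zpow_iff_right₀ hp1] at hnormf
    omega
  obtain ⟨W₀, _, _, _, D₀, hiso, hN0, hopt⟩ :=
    Summit.BirchSwinnertonDyer.Rank1Residual.X12.exists_isIsogenous_optimal hnf W
  have hCM0 : W₀.HasCM :=
    (Summit.BirchSwinnertonDyer.Rank1Residual.X12.hasCM_iff_of_isIsogenous hiso).mp hCM
  have hin0 : Literature.NumberTheory.EllipticCurves.Rank1Residual.CMInert W₀ p :=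
    (Summit.BirchSwinnertonDyer.Rank1Residual.X12.cmInert_iff_of_isIsogenous hiso hCM p).mp hin
  have hX : Literature.NumberTheory.EllipticCurves.Rank1Residual.ClassX12 W p :=
    ⟨hCM, hr, Or.inr (Or.inr (Or.inr hbad))⟩
  have hX0 : Literature.NumberTheory.EllipticCurves.Rank1Residual.ClassX12 W₀ p :=
    (Summit.BirchSwinnertonDyer.Rank1Residual.X12.classX12_iff_of_isIsogenous hiso p).mp hX
  have hr0 : W₀.analyticRank = 1 := hX0.2.1
  have hpN : p ∣ W.conductorNorm ℤ :=
    (W.dvd_conductorNorm_iff_not_hasGoodReductionAtPrime p).mpr hbad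
  have hpN0 : p ∣ W₀.conductorNorm ℤ := hN0 ▸ hpN
  have hbad0 : ¬ Literature.NumberTheory.EllipticCurves.Rank1Residual.Good W₀ p :=
    (W₀.dvd_conductorNorm_iff_not_hasGoodReductionAtPrime p).mp hpN0
  have hc0 : ¬ (p : ℤ) ∣ D₀.c := by
    by_cases hp7 : 7 < p
    · exact Summit.BirchSwinnertonDyer.Rank1Residual.X12.not_dvd_maninConstant_of_hasCM_of_not_cmSplit_of_optimal
        hEdx hDeu W₀ p hCM0 hp7 hin0.2 D₀ hopt
    · have h6 : p ≠ 6 := by rintro rfl; exact absurd hp (by decide)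
      exact h5 W₀ p D₀ hCM0 hr0 (by omega) hin0 hbad0 hopt
  have hb0 : Literature.NumberTheory.EllipticCurves.BSDp W₀ p := by
    obtain ⟨K, _, _, hK, hd4, hHN, hLt, hadm⟩ := h7 W₀ p hCM0 hr0 hp5 hin0 hbad0
    obtain ⟨β, hβ⟩ :=
      Literature.NumberTheory.EllipticCurves.exists_dvd_sq_sub_discr_holds (W₀.conductorNorm ℤ) K hK hHN
    obtain ⟨H, -⟩ :=
      Literature.NumberTheory.EllipticCurves.nonempty_heegnerDatum_holds (W₀.conductorNorm ℤ) K hK hβ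
    obtain ⟨ι⟩ : Nonempty (K →+* ℂ) := inferInstance
    obtain ⟨P, hP⟩ :=
      Literature.NumberTheory.EllipticCurves.heegnerPointComplex_mem_range_map_holds
        (W₀.conductorNorm ℤ) W₀ K hK hHN D₀ H ι
    have hμ : ¬ p ∣ NumberField.Units.torsionOrder K :=
      Summit.BirchSwinnertonDyer.Rank1Residual.X12.not_dvd_torsionOrder_of_four_lt_natAbs_discr p
        (by omega) K hK hd4
    refine Summit.BirchSwinnertonDyer.Rank1Residual.X12.bsdp_of_classX12_of_not_cmRamified_of_indexLowerBoundAt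
      hGZ hKo hMN hGZK hmod hnf hFH hCM8 W₀ p K D₀ H ι P hX0 hp5 hin0.1 hK hHN hP hc0 hμ hLt ?_
    intro hfin
    obtain ⟨κ, γ, 𝔭, hκ, hγ, h𝔭, he, hf⟩ :=
      Summit.BirchSwinnertonDyer.Rank1Residual.X11b.exists_anticyclotomic_generator_degreeOnePrime p K
        hK (hHN.of_dvd hpN0)
    haveI : Fact (κ.IsTopGenerator γ) := ⟨hγ⟩
    obtain ⟨𝔭', h𝔭', hne'⟩ : ∃ 𝔭' : IsDedekindDomain.HeightOneSpectrum (NumberField.RingOfIntegers K),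
        ((p : ℕ) : NumberField.RingOfIntegers K) ∈ 𝔭'.asIdeal ∧ 𝔭' ≠ 𝔭 := by
      have hs : Summit.BirchSwinnertonDyer.Rank1Residual.X11b.SplitsIn K p :=
        (hHN.of_dvd hpN0) p hp (dvd_refl p)
      have hv := Summit.BirchSwinnertonDyer.Rank1Residual.X11b.under_eq_ratPlace_of_mem (K := K) (p := p) h𝔭
      have hcard : {w : IsDedekindDomain.HeightOneSpectrum (NumberField.RingOfIntegers K) |
          w.under (NumberField.RingOfIntegers ℚ) =
            Summit.BirchSwinnertonDyer.Rank1Residual.X11b.ratPlace p}.ncard = 2 := by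
        rw [← Summit.BirchSwinnertonDyer.Rank1Residual.X11b.ncard_primesOver_span_eq K
            (Summit.BirchSwinnertonDyer.Rank1Residual.X11b.ratPlace p),
          Summit.BirchSwinnertonDyer.Rank1Residual.X11b.primesEquiv_ratPlace]
        exact hs
      rcases Literature.NumberTheory.EllipticCurves.placesOver_trichotomy_of_finrank_eq_two K hK.1
          (Summit.BirchSwinnertonDyer.Rank1Residual.X11b.ratPlace p) with
        ⟨w₁, w₂, hne, hset, -⟩ | ⟨w, hset, -, -⟩ | ⟨w, hset, -, -⟩
      · have hmem𝔭 : 𝔭 ∈ ({w₁, w₂} : Set (IsDedekindDomain.HeightOneSpectrum (NumberField.RingOfIntegers K))) :=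
          hset ▸ hv
        have hw₁ : w₁ ∈ {w : IsDedekindDomain.HeightOneSpectrum (NumberField.RingOfIntegers K) |
            w.under (NumberField.RingOfIntegers ℚ) = Summit.BirchSwinnertonDyer.Rank1Residual.X11b.ratPlace p} :=
          hset ▸ Set.mem_insert _ _
        have hw₂ : w₂ ∈ {w : IsDedekindDomain.HeightOneSpectrum (NumberField.RingOfIntegers K) |
            w.under (NumberField.RingOfIntegers ℚ) = Summit.BirchSwinnertonDyer.Rank1Residual.X11b.ratPlace p} :=
          hset ▸ Set.mem_insert_of_mem _ (Set.mem_singleton _)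
        rcases hmem𝔭 with rfl | h2
        · exact ⟨w₂, Summit.BirchSwinnertonDyer.Rank1Residual.X11b.mem_of_under_eq_ratPlace (K := K) (p := p) hw₂,
            hne.symm⟩
        · rw [Set.mem_singleton_iff] at h2
          subst h2
          exact ⟨w₁, Summit.BirchSwinnertonDyer.Rank1Residual.X11b.mem_of_under_eq_ratPlace (K := K) (p := p) hw₁,
            hne⟩
      · rw [hset, Set.ncard_singleton] at hcard; exact absurd hcard (by norm_num)
      · rw [hset, Set.ncard_singleton] at hcard; exact absurd hcard (by norm_num)
    obtain ⟨f, hfW, ι', hι', ΩK, Ωp, Q, hΩK, hQ, u, hu1, hu⟩ :=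
      h2 h8 W₀ p K D₀ H ι P hCM0 hr0 hp5 hin0 hbad0 hK hHN hd4 hadm hP hc0 hLt κ hκ γ 𝔭 h𝔭 he hf
    have hdiv := h1 W₀ p K hCM0 hr0 hp5 hin0 hbad0 hK hHN hd4 hadm hLt κ hκ γ 𝔭 h𝔭 he hf 𝔭' h𝔭' hne' f hfW
      ι' hι' ΩK Ωp Q hΩK hQ
    obtain ⟨n, ⟨htors, g, hg, hg0, hgn⟩, hctl⟩ :=
      h3 W₀ p K D₀ H ι P hCM0 hr0 hp5 hin0 hbad0 hK hHN hd4 hadm hP hc0 hLt κ hκ γ 𝔭 h𝔭 he hf 𝔭' h𝔭' hne'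
    have hmem : (Summit.BirchSwinnertonDyer.Rank1Residual.X11b.R1.toCpInt p) (PowerSeries.constantCoeff g) ∈
        Ideal.span {PowerSeries.constantCoeff Q} := by
      rw [hg, Ideal.map_span, Set.image_singleton] at hdiv
      exact (Ideal.span_singleton_le_iff_mem _).mp hdiv
    obtain ⟨hx0, hle⟩ := key hg0 hmem hu1 hu
    rw [Summit.BirchSwinnertonDyer.Rank1Residual.X11b.Halves.valuation_logOmega hx0, hgn] at hle
    haveI := hfin
    haveI : Finite (AddCommGroup.primaryComponent (W₀.baseChange K).sha p) :=
      Finite.of_injective _ Subtype.val_injective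
    have h : 2 * (padicValNat p (AddSubgroup.zmultiples P).index : ℤ) ≤
        (padicValNat p (Nat.card (AddCommGroup.primaryComponent (W₀.baseChange K).sha p)) : ℤ) +
          padicValNat p (Summit.BirchSwinnertonDyer.Rank1Residual.X11b.tamagawaProductSplit W₀ K) := by
      push_cast at hle hctl ⊢
      omega
    rw [Summit.BirchSwinnertonDyer.Rank1Residual.X11b.padicValNat_tamagawaProductSplit_eq_of_heegner
        W₀ p K hp5 hK rfl hHN,
      Summit.BirchSwinnertonDyer.Rank1Residual.X11b.padicValNat_tamagawaProduct_baseChange_of_heegner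
        W₀ p hp5 K hK rfl hHN,
      Literature.NumberTheory.EllipticCurves.padicValNat_card_addPrimaryComponent] at h
    unfold Summit.BirchSwinnertonDyer.Rank1Residual.X11b.IndexLowerBoundAt
    rw [WeierstrassCurve.shaOrder]
    omega
  exact Literature.NumberTheory.EllipticCurves.Wuthrich2014.bsdp_of_isIsogenous hCassels hiso
    (hGZK W₀ (by rw [hr0])).2 (W₀.leadingLCoeff_ne_zero_holds (hmod W₀)) hb0

end Summit.BirchSwinnertonDyer.BirchSwinnertonDyer.Theorems.BiquadraticEisensteinDescentAssembly
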